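import Summits.CriticalPhenomena.PercolationContinuityZ3.Theorems.FK.Transplant.KNFreeSlabOuterRoutes
import HarnessLib

/-!
# FRONTIER TRANSPLANT, binder 2 (TP_FK) — T4-SLAB (L6): case lemmas O23 (outer, `F` extends beyond another face) and T4
# (inner, the flat coordinate of `F` is interior: direct route) of the router

Support file (`--supports stmt-CriticalPhenomena-4575`, helper) of the FRONTIER TRANSPLANT sub-cell (`fk-continuity/transplant/`,
seat `prim-bschramm-fkt-p1`); builds on p205010 (kernel theorem, internal audit signed; external expert review pending).
0 definitions · 0 named facts · 0 sorries · standard axioms. File 8/18 of the bytes-first package (R60 (3)(β)) of the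
UNFUNDED memo row `T4-SLAB [g122, R60]` (re-described R62 (E)); proposable only on a coordinator ruling.
Registered R63 (cell INBOX l.4709, 2026-08-23); registry row T4s; lead label T4s-08 (fkt-lead L22, l.4677).

HONEST FRAMING (page 1, cell rule). The transplant's theorem of record `ufsc0_of_freeBoundaryHypothesis_r3` (p248245) is
CONDITIONAL on FH AND on TP_FK = `KNFreeTargetHittable d q p`, both OPEN at the same `p` for `q > 1` near `p_c(q)` (⇔ GRC Conj.
(5.103) via K1; barrier note `Literature.Barriers.CriticalPhenomena.SamePFreeBoundaryCriteria`, FBN-01, cited first); the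
transplant is a typed reduction, not a proof of FK continuity. THIS FILE: case lemmas `lane_caseO23` (`v + ℓF` extends beyond a face `f ∉ {i, c}` of the level box: outer route into
the face box of `f`) and `lane_caseT4` (inner contact, the flat coordinate `c_a` of `F` interior to the level box
minus its collar: direct route), with the interval arithmetic `max_add_le_min`. It proves nothing about either binder and says nothing at `p ↓ p_c(q)`; NOT `_r4`; `_r3` « 2 / 0 ☑ », n_open = 2,
BINDER-OWNERS, FO-19 NO-GO unchanged.

Declarations: `lane_caseO23`, `max_add_le_min`, `lane_caseT4`.

References: G. Grimmett, *The Random-Cluster Model*, Springer 2006, Thm. (3.1) eq. (3.4), Thm. (3.7), Thm. (3.8), Thm. (3.21)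
eq. (3.22), Lemma (4.13), §5.7 [Grimmett2006]; G. Kozma, S. Nitzan, arXiv:2401.12397 (2024), §4 Lemma 10 Step IV (pp. 19–21) [KozmaNitzan2024].
-/

noncomputable section

namespace Summit.CriticalPhenomena.PercolationContinuityZ3.Theorems.FK

open MeasureTheory
open scoped ENNReal Classical
open Literature.Probability.Percolation Literature.Probability.LatticeModels SimpleGraph
open Literature.Probability.Percolation.GadgetSystem Literature.Probability.Percolation.KozmaNitzan Transplant
open Literature.Barriers.CriticalPhenomena

variable {d : ℕ}

/-- **Case O23 (outer, around a second face): `U` sticks out beyond a face `(f, τf)`, `f ∉ {i, c}`, by at least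
`2·Nbig + 2` inside `F`'s `f`-range** (for `f = a`: the far set lies beyond that face). Exit on layer 1; route T2/T3:
face box beyond `(i, σ)` up to the junction `J = (i ↦ yi + σ, f ↦ yf + τf, c ↦ ζ, b ↦ z_b)`, then the face box beyond
`(f, τf)` to `t = (c ↦ ζ, f ↦ far end of F, b ↦ v_b + ℓ·loF_b)`.
[cite: KozmaNitzan2024, §4 Lemma 10 Step IV (pp. 19–21); Grimmett2006, Thm. (3.1) eq. (3.4), Thm. (3.8), eq. (3.22), §5.7 eq. (5.102)] -/
theorem lane_caseO23 {q : ℝ} (hq : 1 ≤ q) (p : unitInterval) (hd : 3 ≤ d) {L : ℕ}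
    {β : ℝ} (hβ0 : 0 ≤ β) (hβ1 : β ≤ 1)
    (hβ : ∀ (N : ℕ) (g : zdGraph d ≃g zdGraph d) (u z : Site d), u ∈ fkSlab d L N → z ∈ fkSlab d L N →
      β ≤ (fkLaw ((fkSlab d L N).image g) (restrW (↑((fkSlab d L N).image g) : Set (Site d)) (lattW d p)) q).real
        (openConnIn (↑((fkSlab d L N).image g) : Set (Site d)) (g u) (g z)))
    (Lo Hi : Site d) (i : Fin d) (σ yi : ℤ) (hface : (σ = 1 ∧ yi = Hi i) ∨ (σ = -1 ∧ yi = Lo i))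
    (M₀ M : ℕ) (hM₀ : M₀ ≤ M) (v : Site d) (hvi : v i = yi - σ * ((M : ℤ) + 1))
    (hvb : ∀ b, b ≠ i → Lo b + M + 1 ≤ v b ∧ v b ≤ Hi b - M - 1)
    (S : Finset (Site d)) (hS : S ⊆ Finset.Icc (Lo + 1) (Hi - 1))
    (ℓ : ℕ) (g : Geom d) (hloQ : ∀ b, g.loQ b ≤ -1) (hhiQ : ∀ b, 1 ≤ g.hiQ b)
    (hFQ : ∀ b, g.loQ b ≤ g.loF b ∧ g.hiF b ≤ g.hiQ b) (hF : ∀ b, g.loF b ≤ g.hiF b)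
    (c : Fin d) (hci : c ≠ i) (ζ : ℤ) (hζI : v c + ℓ * g.loF c ≤ ζ ∧ ζ ≤ v c + ℓ * g.hiF c) (hζv : |ζ - v c| ≤ M₀)
    (z : Site d) (hzi : z i = yi - σ) (hzc : z c = ζ) (hzv : ∀ b, b ≠ i → |z b - v b| ≤ M₀)
    (Nbig mstar : ℕ) (hLN : L ≤ Nbig) (hℓ : (M : ℤ) + 2 * L + 2 * Nbig + 2 ≤ ℓ)
    (hm : ∀ b, (ℓ : ℤ) * g.hiQ b - ℓ * g.loQ b + 2 * M + 2 ≤ (mstar : ℤ) * Nbig)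
    (f : Fin d) (hfi : f ≠ i) (hfc : f ≠ c) (τf yf : ℤ) (hfaceF : (τf = 1 ∧ yf = Hi f) ∨ (τf = -1 ∧ yf = Lo f))
    (hO23 : (τf = 1 → yf + 2 * Nbig + 2 ≤ v f + ℓ * g.hiF f) ∧ (τf = -1 → v f + ℓ * g.loF f + 2 * Nbig + 2 ≤ yf)) :
    ∃ t w : Site d, t ∈ g.Fset ℓ v ∧ (z = w ∨ ¬ (zdGraph d).Adj z w) ∧
      ((p : ℝ) / (p + q * (1 - p))) ^ 2 * β ^ (d * mstar) * β ^ (d * mstar) ≤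
        (fkLaw (((g.Qset ℓ v).filter fun x => |x c - ζ| ≤ (L : ℤ)) \ (S \ {z, w}))
          (restrW (↑(((g.Qset ℓ v).filter fun x => |x c - ζ| ≤ (L : ℤ)) \ (S \ {z, w})) : Set (Site d))
            (lattW d p)) q).real
        (openConnIn (↑(((g.Qset ℓ v).filter fun x => |x c - ζ| ≤ (L : ℤ)) \ (S \ {z, w})) : Set (Site d)) z t) := by
  -- linear facts (products are atoms)
  have hℓ0 : (0 : ℤ) ≤ ℓ := Nat.cast_nonneg ℓ
  have hA : ∀ b, (ℓ : ℤ) * g.loQ b ≤ -ℓ := fun b => by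
    have := mul_le_mul_of_nonneg_left (hloQ b) hℓ0; linarith
  have hB : ∀ b, (ℓ : ℤ) ≤ ℓ * g.hiQ b := fun b => by
    have := mul_le_mul_of_nonneg_left (hhiQ b) hℓ0; linarith
  have hAF : ∀ b, (ℓ : ℤ) * g.loQ b ≤ ℓ * g.loF b := fun b => mul_le_mul_of_nonneg_left (hFQ b).1 hℓ0
  have hFF : ∀ b, (ℓ : ℤ) * g.loF b ≤ ℓ * g.hiF b := fun b => mul_le_mul_of_nonneg_left (hF b) hℓ0
  have hFB : ∀ b, (ℓ : ℤ) * g.hiF b ≤ ℓ * g.hiQ b := fun b => mul_le_mul_of_nonneg_left (hFQ b).2 hℓ0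
  have hM₀' : (M₀ : ℤ) ≤ M := by exact_mod_cast hM₀
  have hzv' : ∀ b, b ≠ i → v b - M₀ ≤ z b ∧ z b ≤ v b + M₀ := fun b hb => by
    have := hzv b hb; rw [abs_le] at this; constructor <;> linarith [this.1, this.2]
  have hζv' : v c - M₀ ≤ ζ ∧ ζ ≤ v c + M₀ := by rw [abs_le] at hζv; constructor <;> linarith [hζv.1, hζv.2]
  -- the `i`-interval of the face box beyond `(i, σ)`
  set aI : ℤ := if σ = 1 then yi + 1 else v i + ℓ * g.loQ i with haI
  set bI : ℤ := if σ = 1 then v i + ℓ * g.hiQ i else yi - 1 with hbI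
  have hI : v i + ℓ * g.loQ i ≤ aI ∧ bI ≤ v i + ℓ * g.hiQ i ∧ aI + 2 * (Nbig : ℤ) ≤ bI ∧
      (∀ w : ℤ, aI ≤ w → w ≤ bI → 0 ≤ σ * (w - yi)) ∧ (aI ≤ yi + σ ∧ yi + σ ≤ bI) ∧
      |yi + σ - (v i + ℓ * g.loF i)| ≤ (mstar : ℤ) * Nbig ∧
      (v i + ℓ * g.loQ i ≤ yi - 1 ∧ yi + 1 ≤ v i + ℓ * g.hiQ i) := by
    have hmi := hm i
    rcases hface with ⟨hσ, -⟩ | ⟨hσ, -⟩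
    · simp only [haI, hbI, hσ, if_true]
      rw [hσ] at hvi
      refine ⟨by linarith [hA i], le_rfl, by linarith [hB i], fun w hw _ => by linarith, ⟨le_rfl, by linarith [hB i]⟩, ?_,
        ⟨by linarith [hA i], by linarith [hB i]⟩⟩
      rw [abs_le]; constructor <;> linarith [hAF i, hFF i, hFB i, hA i, hB i]
    · simp only [haI, hbI, hσ, show (-1 : ℤ) ≠ 1 by norm_num, if_false]
      rw [hσ] at hvi
      refine ⟨le_rfl, by linarith [hB i], by linarith [hA i], fun w _ hw => by linarith, ⟨by linarith [hA i], by linarith⟩, ?_,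
        ⟨by linarith [hA i], by linarith [hB i]⟩⟩
      rw [abs_le]; constructor <;> linarith [hAF i, hFF i, hFB i, hA i, hB i]
  obtain ⟨haQ, hbQ, hIN, hIout, hx2I, hdistI, hQi⟩ := hI
  -- the `f`-interval of the second face box and the target's `f`-coordinate (the far end of `F`)
  set aF : ℤ := if τf = 1 then yf + 1 else v f + ℓ * g.loQ f with haF
  set bF : ℤ := if τf = 1 then v f + ℓ * g.hiQ f else yf - 1 with hbF
  set tF : ℤ := v f + ℓ * (if τf = 1 then g.hiF f else g.loF f) with htF'
  have hvf := hvb f hfi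
  have hFf : v f + ℓ * g.loQ f ≤ aF ∧ bF ≤ v f + ℓ * g.hiQ f ∧ aF + 2 * (Nbig : ℤ) ≤ bF ∧
      (∀ w : ℤ, aF ≤ w → w ≤ bF → 0 ≤ τf * (w - yf)) ∧ (aF ≤ yf + τf ∧ yf + τf ≤ bF) ∧ (aF ≤ tF ∧ tF ≤ bF) ∧
      (v f + ℓ * g.loF f ≤ tF ∧ tF ≤ v f + ℓ * g.hiF f) ∧
      |z f - (yf + τf)| ≤ (mstar : ℤ) * Nbig ∧ |yf + τf - tF| ≤ (mstar : ℤ) * Nbig ∧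
      (v f + ℓ * g.loQ f ≤ yf + τf ∧ yf + τf ≤ v f + ℓ * g.hiQ f) := by
    have hmf := hm f
    have hzf := hzv' f hfi
    rcases hfaceF with ⟨hτ, hy⟩ | ⟨hτ, hy⟩
    · have h1 := hO23.1 hτ
      simp only [haF, hbF, htF', hτ, if_true]
      rw [hy] at h1 ⊢
      refine ⟨by linarith [hA f], le_rfl, by linarith [hFB f], fun w hw _ => by linarith, ⟨le_rfl, by linarith [hFB f]⟩,
        ⟨by linarith, by linarith [hFB f]⟩, ⟨by linarith [hFF f], le_rfl⟩, ?_, ?_, ⟨by linarith [hA f], by linarith [hFB f]⟩⟩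
      · rw [abs_le]; constructor <;> linarith [hFB f, hA f, hB f]
      · rw [abs_le]; constructor <;> linarith [hFB f, hA f, hB f]
    · have h1 := hO23.2 hτ
      simp only [haF, hbF, htF', hτ, show (-1 : ℤ) ≠ 1 by norm_num, if_false]
      rw [hy] at h1 ⊢
      refine ⟨le_rfl, by linarith [hB f], by linarith [hAF f], fun w _ hw => by linarith, ⟨by linarith [hAF f], by linarith⟩,
        ⟨by linarith [hAF f], by linarith⟩, ⟨le_rfl, by linarith [hFF f]⟩, ?_, ?_, ⟨by linarith [hAF f], by linarith [hB f]⟩⟩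
      · rw [abs_le]; constructor <;> linarith [hAF f, hA f, hB f]
      · rw [abs_le]; constructor <;> linarith [hAF f, hA f, hB f]
  obtain ⟨haFQ, hbFQ, hFN, hFout, hJfI, htFI, htFF, hdJf, hdtf, hJfQ⟩ := hFf
  -- the junction and the target
  set J : Site d := fun b => if b = i then yi + σ else if b = f then yf + τf else z b with hJdef
  set t : Site d := fun b => if b = c then ζ else if b = f then tF else v b + ℓ * g.loF b with htdef
  have htF : t ∈ g.Fset ℓ v := by
    rw [Geom.Fset, mem_Icc_iff]
    intro b
    simp only [Pi.add_apply, Pi.smul_apply, smul_eq_mul, htdef]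
    by_cases hbc : b = c
    · rw [if_pos hbc, hbc]; exact hζI
    · rw [if_neg hbc]
      by_cases hbf : b = f
      · rw [if_pos hbf, hbf]; exact htFF
      · rw [if_neg hbf]; exact ⟨le_rfl, by linarith [hFF b]⟩
  refine ⟨t, z, htF, Or.inl rfl, ?_⟩
  have hLℓ : (Nbig : ℤ) ≤ ℓ := by linarith
  have hNℓ : Nbig ≤ ℓ := by exact_mod_cast hLℓ
  have hL0 : (0 : ℤ) ≤ (mstar : ℤ) * Nbig := by positivity
  refine outer_faceBox_route hq p hd hβ0 hβ1 hβ Lo Hi i σ yi hface v S hS ℓ g hloQ hhiQ c hci z z ζ hzi hzc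
    (fun b hb => ⟨by linarith [hzv' b hb, hA b], by linarith [hzv' b hb, hB b]⟩) hQi
    ⟨by linarith [hζv'.1, hA c], by linarith [hζv'.2, hB c]⟩ aI bI haQ hbQ hIout hx2I Nbig mstar hIN hNℓ hLN
    J ?_ ?_ ?_ ?_ ?_ ?_ f hfc τf yf hfaceF aF bF haFQ hbFQ hFout ?_ Nbig mstar hFN hNℓ hLN t ?_ ?_ ?_ ?_ ?_
  -- junction: slab, `i`-range, other coordinates, distances from `x₂`
  · simp only [hJdef, if_neg hci, if_neg hfc.symm]; rw [hzc]; constructor <;> linarith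
  · simp only [hJdef, if_true]; exact hx2I
  · intro b hbc hbi
    simp only [hJdef, if_neg hbi]
    by_cases hbf : b = f
    · rw [if_pos hbf, hbf]; exact hJfQ
    · rw [if_neg hbf]; exact ⟨by linarith [hzv' b hbi, hA b], by linarith [hzv' b hbi, hB b]⟩
  · intro b hbc hbi
    simp only [hJdef, if_neg hbi]
    by_cases hbf : b = f
    · rw [if_pos hbf, hbf]; exact hdJf
    · rw [if_neg hbf, sub_self, abs_zero]; exact hL0
  · simp only [hJdef, if_true, sub_self, abs_zero]; exact hL0
  · simp only [hJdef, if_neg hci, if_neg hfc.symm]; rw [hzc, sub_self, abs_zero]; positivity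
  · simp only [hJdef, if_neg hfi, if_true]; exact hJfI
  -- target: slab, `f`-range, other coordinates, distances from `J`
  · simp only [htdef, if_true]; constructor <;> linarith
  · simp only [htdef, if_neg hfc, if_true]; exact htFI
  · intro b hbc hbf; simp only [htdef, if_neg hbc, if_neg hbf]; constructor <;> linarith [hAF b, hFF b, hFB b]
  · intro b hbc
    simp only [hJdef, htdef, if_neg hbc]
    by_cases hbi : b = i
    · rw [if_pos hbi, if_neg (hbi ▸ hfi.symm : b ≠ f), hbi]; exact hdistI
    · rw [if_neg hbi]
      by_cases hbf : b = f
      · rw [if_pos hbf, if_pos hbf]; exact hdtf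
      · rw [if_neg hbf, if_neg hbf]
        have := hm b; rw [abs_le]; constructor <;> linarith [hzv' b hbi, hAF b, hFF b, hFB b, hA b, hB b]
  · simp only [hJdef, htdef, if_neg hci, if_neg hfc.symm, if_true]; rw [hzc, sub_self, abs_zero]; positivity


/-- `max x y + k ≤ min u w` from the four componentwise inequalities. [folklore] -/
theorem max_add_le_min {x y u w k : ℤ} (h1 : x + k ≤ u) (h2 : x + k ≤ w) (h3 : y + k ≤ u) (h4 : y + k ≤ w) :
    max x y + k ≤ min u w := by
  rw [← max_add_add_right]
  exact max_le (le_min h1 h2) (le_min h3 h4)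

/-- **Case T4 (inner, direct): the level box is fat in every direction `b ≠ c` and `F`'s flat coordinate
`c_a = v_a + ℓ·loF_a` lies in the interior range `[Lo_a+T+1, Hi_a-T-1]`.** Exit on layer `T`; route T4 with the
interior slab box; target `t = (c ↦ ζ, a ↦ c_a, b ↦ v_b)`.
[cite: KozmaNitzan2024, §4 Lemma 10 Step IV (pp. 19–21); Grimmett2006, Thm. (3.1) eq. (3.4), Thm. (3.8), eq. (3.22), §5.7 eq. (5.102)] -/
theorem lane_caseT4 {q : ℝ} (hq : 1 ≤ q) (p : unitInterval) (hd : 3 ≤ d) {L : ℕ}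
    {β : ℝ} (hβ0 : 0 ≤ β) (hβ1 : β ≤ 1)
    (hβ : ∀ (N : ℕ) (g : zdGraph d ≃g zdGraph d) (u z : Site d), u ∈ fkSlab d L N → z ∈ fkSlab d L N →
      β ≤ (fkLaw ((fkSlab d L N).image g) (restrW (↑((fkSlab d L N).image g) : Set (Site d)) (lattW d p)) q).real
        (openConnIn (↑((fkSlab d L N).image g) : Set (Site d)) (g u) (g z)))
    (Lo Hi : Site d) (i : Fin d) (σ yi : ℤ) (hface : (σ = 1 ∧ yi = Hi i) ∨ (σ = -1 ∧ yi = Lo i))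
    (M₀ M T : ℕ) (hM₀ : M₀ + L + T ≤ M) (v : Site d) (hvi : v i = yi - σ * ((M : ℤ) + 1))
    (hvb : ∀ b, b ≠ i → Lo b + M + 1 ≤ v b ∧ v b ≤ Hi b - M - 1)
    (S : Finset (Site d)) (hSint : ∀ x ∈ S, x ∉ Finset.Icc (Lo + ((T : Site d) + 1)) (Hi - ((T : Site d) + 1)))
    (ℓ : ℕ) (g : Geom d) (hloQ : ∀ b, g.loQ b ≤ -1) (hhiQ : ∀ b, 1 ≤ g.hiQ b)
    (hFQ : ∀ b, g.loQ b ≤ g.loF b ∧ g.hiF b ≤ g.hiQ b) (hF : ∀ b, g.loF b ≤ g.hiF b)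
    (a : Fin d) (hF0 : ∀ b, b ≠ a → g.loF b ≤ 0 ∧ 0 ≤ g.hiF b)
    (c : Fin d) (hci : c ≠ i) (ζ : ℤ) (hζI : v c + ℓ * g.loF c ≤ ζ ∧ ζ ≤ v c + ℓ * g.hiF c)
    (hζv : |ζ - v c| ≤ M₀)
    (z : Site d) (hzi : z i = yi - σ * T) (hzc : z c = ζ) (hzv : ∀ b, b ≠ i → |z b - v b| ≤ M₀)
    (Nbig mstar : ℕ) (hLN : L ≤ Nbig) (hm1 : 1 ≤ mstar) (hℓ : (M : ℤ) + 2 * T + 2 * Nbig + 2 * L + 4 ≤ ℓ)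
    (hm : ∀ b, (ℓ : ℤ) * g.hiQ b - ℓ * g.loQ b + 2 * M + 2 ≤ (mstar : ℤ) * Nbig)
    (hfatX : ∀ b, b ≠ c → Lo b + M + 2 * T + 2 * Nbig + 4 ≤ Hi b)
    (hT4 : Lo a + T + 1 ≤ v a + ℓ * g.loF a ∧ v a + ℓ * g.loF a ≤ Hi a - T - 1) :
    ∃ t w : Site d, t ∈ g.Fset ℓ v ∧ (z = w ∨ ¬ (zdGraph d).Adj z w) ∧
      ((p : ℝ) / (p + q * (1 - p))) * β ^ (d * mstar) ≤
        (fkLaw (((g.Qset ℓ v).filter fun x => |x c - ζ| ≤ (L : ℤ)) \ (S \ {z, w}))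
          (restrW (↑(((g.Qset ℓ v).filter fun x => |x c - ζ| ≤ (L : ℤ)) \ (S \ {z, w})) : Set (Site d))
            (lattW d p)) q).real
        (openConnIn (↑(((g.Qset ℓ v).filter fun x => |x c - ζ| ≤ (L : ℤ)) \ (S \ {z, w})) : Set (Site d)) z t) := by
  -- linear facts (products are atoms)
  have hℓ0 : (0 : ℤ) ≤ ℓ := Nat.cast_nonneg ℓ
  have hA : ∀ b, (ℓ : ℤ) * g.loQ b ≤ -ℓ := fun b => by
    have := mul_le_mul_of_nonneg_left (hloQ b) hℓ0; linarith
  have hB : ∀ b, (ℓ : ℤ) ≤ ℓ * g.hiQ b := fun b => by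
    have := mul_le_mul_of_nonneg_left (hhiQ b) hℓ0; linarith
  have hAF : ∀ b, (ℓ : ℤ) * g.loQ b ≤ ℓ * g.loF b := fun b => mul_le_mul_of_nonneg_left (hFQ b).1 hℓ0
  have hFF : ∀ b, (ℓ : ℤ) * g.loF b ≤ ℓ * g.hiF b := fun b => mul_le_mul_of_nonneg_left (hF b) hℓ0
  have hFB : ∀ b, (ℓ : ℤ) * g.hiF b ≤ ℓ * g.hiQ b := fun b => mul_le_mul_of_nonneg_left (hFQ b).2 hℓ0
  have hF0' : ∀ b, b ≠ a → (ℓ : ℤ) * g.loF b ≤ 0 ∧ 0 ≤ (ℓ : ℤ) * g.hiF b := fun b hb =>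
    ⟨mul_nonpos_of_nonneg_of_nonpos hℓ0 (hF0 b hb).1, mul_nonneg hℓ0 (hF0 b hb).2⟩
  have hM₀' : (M₀ : ℤ) + L + T ≤ M := by exact_mod_cast hM₀
  have hL0 : (0 : ℤ) ≤ L := Nat.cast_nonneg L
  have hT0 : (0 : ℤ) ≤ T := Nat.cast_nonneg T
  have hzv' : ∀ b, b ≠ i → v b - M₀ ≤ z b ∧ z b ≤ v b + M₀ := fun b hb => by
    have := hzv b hb; rw [abs_le] at this; constructor <;> linarith [this.1, this.2]
  have hζv' : v c - M₀ ≤ ζ ∧ ζ ≤ v c + M₀ := by rw [abs_le] at hζv; constructor <;> linarith [hζv.1, hζv.2]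
  have hmN : (0 : ℤ) ≤ (mstar : ℤ) * Nbig := by positivity
  have hNle : (Nbig : ℤ) ≤ (mstar : ℤ) * Nbig := by
    have := mul_le_mul_of_nonneg_right (show (1 : ℤ) ≤ mstar by exact_mod_cast hm1) (Nat.cast_nonneg Nbig)
    linarith
  -- `i`-coordinates: depth facts of `v i`, `x₁ i = yi - σ(T+1)`
  have hIi : Lo i + T + 1 ≤ v i ∧ v i ≤ Hi i - T - 1 ∧
      Lo i + T + 1 ≤ yi - σ * ((T : ℤ) + 1) ∧ yi - σ * ((T : ℤ) + 1) ≤ Hi i - T - 1 ∧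
      |yi - σ * ((T : ℤ) + 1) - v i| ≤ (M : ℤ) := by
    have hfi := hfatX i hci.symm
    rcases hface with ⟨hσ, hy⟩ | ⟨hσ, hy⟩
    · rw [hσ, hy] at hvi ⊢; rw [hvi]
      refine ⟨by linarith, by linarith, by linarith, by linarith, ?_⟩
      rw [abs_le]; constructor <;> linarith
    · rw [hσ, hy] at hvi ⊢; rw [hvi]
      refine ⟨by linarith, by linarith, by linarith, by linarith, ?_⟩
      rw [abs_le]; constructor <;> linarith
  obtain ⟨hvi1, hvi2, hx1i1, hx1i2, hx1v⟩ := hIi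
  have hvIn : ∀ b, Lo b + T + 1 ≤ v b ∧ v b ≤ Hi b - T - 1 := by
    intro b
    by_cases hb : b = i
    · rw [hb]; exact ⟨hvi1, hvi2⟩
    · have := hvb b hb; constructor <;> linarith [this.1, this.2]
  -- the target
  set t : Site d := fun b => if b = c then ζ else if b = a then v a + ℓ * g.loF a else v b with htdef
  have htF : t ∈ g.Fset ℓ v := by
    rw [Geom.Fset, mem_Icc_iff]
    intro b
    simp only [Pi.add_apply, Pi.smul_apply, smul_eq_mul, htdef]
    by_cases hbc : b = c
    · rw [if_pos hbc, hbc]; exact hζI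
    · rw [if_neg hbc]
      by_cases hba : b = a
      · rw [if_pos hba, hba]; exact ⟨le_rfl, by linarith [hFF a]⟩
      · rw [if_neg hba]; constructor <;> linarith [hF0' b hba]
  refine ⟨t, z, htF, Or.inl rfl, ?_⟩
  have hzQ : z ∈ g.Qset ℓ v := by
    refine mem_Qset_of_forall fun b => ?_
    by_cases hb : b = i
    · rw [hb, hzi, hvi]
      rcases hface with ⟨hσ, -⟩ | ⟨hσ, -⟩ <;> rw [hσ] <;> constructor <;> linarith [hA i, hB i]
    · constructor <;> linarith [hzv' b hb, hA b, hB b]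
  refine inner_direct_route hq p hd hβ0 hβ1 hβ Lo Hi i σ yi hface T v S hSint ℓ g c hci z ζ hzi hzc hzQ Nbig mstar
    hLN hm1 ?_ ⟨by linarith [hζv'.1, hA c], by linarith [hζv'.2, hB c]⟩ ?_ ?_ t z ?_ ?_ ?_
  -- fatness of the interior slab box off the slab direction
  · intro b hbc
    have hfb := hfatX b hbc
    have hv := hvIn b
    exact max_add_le_min (by linarith) (by linarith [hB b]) (by linarith [hA b]) (by linarith [hA b, hB b])
  -- the slab lies in the interior range of direction `c`
  · have := hvb c hci; constructor <;> linarith [hζv'.1, hζv'.2]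
  -- `x₁` lies in the interior slab box
  · intro b hbc
    by_cases hb : b = i
    · rw [hb, Function.update_self]
      refine ⟨max_le hx1i1 ?_, le_min hx1i2 ?_⟩
      · rw [abs_le] at hx1v; linarith [hA i]
      · rw [abs_le] at hx1v; linarith [hB i]
    · rw [Function.update_of_ne hb]
      have := hvb b hb
      refine ⟨max_le (by linarith [hzv' b hb]) (by linarith [hzv' b hb, hA b]),
        le_min (by linarith [hzv' b hb]) (by linarith [hzv' b hb, hB b])⟩
  -- target: slab, interior ranges, distances
  · simp only [htdef, if_true, sub_self, abs_zero]; exact hL0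
  · intro b hbc
    simp only [htdef, if_neg hbc]
    by_cases hba : b = a
    · rw [if_pos hba, hba]
      exact ⟨max_le hT4.1 (by linarith [hAF a]), le_min hT4.2 (by linarith [hFF a, hFB a])⟩
    · rw [if_neg hba]
      exact ⟨max_le (hvIn b).1 (by linarith [hA b]), le_min (hvIn b).2 (by linarith [hB b])⟩
  · intro b hbc
    simp only [htdef, if_neg hbc]
    have hmb := hm b
    by_cases hb : b = i
    · rw [hb, Function.update_self]
      by_cases hia : i = a
      · rw [if_pos hia, ← hia]; rw [abs_le] at hx1v ⊢
        have hmi := hm i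
        constructor <;> linarith [hAF i, hFF i, hFB i, hA i, hB i]
      · rw [if_neg hia]; rw [abs_le] at hx1v ⊢; constructor <;> linarith [hA b, hB b]
    · rw [Function.update_of_ne hb]
      by_cases hba : b = a
      · rw [if_pos hba]; rw [hba] at hmb ⊢
        rw [abs_le]; constructor <;> linarith [hzv' a (hba ▸ hb), hAF a, hFF a, hFB a, hA a, hB a]
      · rw [if_neg hba]; rw [abs_le]; constructor <;> linarith [hzv' b hb, hA b, hB b]

end Summit.CriticalPhenomena.PercolationContinuityZ3.Theorems.FK

end
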